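import Literature.Topology.Immersions.OpenParallelizableImmersionTransport
import HarnessLib

/-!
# Open parallelizable manifolds immerse in `ℝⁿ`: assembly from a compressible exhaustion

Topic `Literature/Topology/Immersions`; the top of the induction proving the named fact
`Literature.Topology.Immersions.Phillips1967_exists_isLocalDiffeomorph_of_isParallelizable`
(Phillips 1967, Cor. 8.2, "if"), in the formal-solution language of
`OpenParallelizableImmersionInduction.lean`. It isolates **exactly what the Morse-theoretic side
of Phillips' proof (§1: a handle presentation of an open manifold without handles of index `n`,
Lemma 1.1 and Cor. 1.2) has to deliver** for the analytic side of the tree to conclude: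

an exhaustion `K₀ = K₁ = ∅ ⊆ K₂ ⊆ ⋯` of the connected non-compact framed manifold `M` by sets
with interiors covering `M`, and for every `j` a closed set `Aⱼ` (in Phillips' presentation:
`Uⱼ₊₁` together with the core of the next handle) such that

* (extension) every formal submersion holonomic near `K_{j+1}` can be made holonomic near `Aⱼ`
  without changing the map on `Kⱼ` — supplied by the tree for cores of index `0`
  (`HolonomicNear.insert`, `OpenParallelizableImmersionPoint.lean`) and index `1`
  (`HolonomicNear.arc`), and by holonomic approximation over cubes for higher index;
* (compression, Phillips' *property A*, Def. p. 176) for every open `V ⊇ Aⱼ` a smooth family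
  `Φ : ℝ × M → M` of local diffeomorphisms (`s ∈ [0, 1]`), fixing `Kⱼ` pointwise, and a smooth
  cut-off `τ : M → [0, 1]` equal to `1` on an open `W ⊇ K_{j+2}` with `Φ(1, W) ⊆ V`.

Then `M` submerges in `ℝⁿ`: the base is the trivial formal submersion `(0, standard frame)`
(holonomic near `∅`), each step is extension followed by transport
(`HolonomicNear.transport`), and the induction scheme
`Phillips1967_exists_isLocalDiffeomorph_of_isParallelizable_of_exhaustion` concludes.

* `Literature.Topology.Immersions.holonomicNear_empty` — the trivial formal submersion.
* `Literature.Topology.Immersions.IsCompressionDatum` — the compression hypothesis (a `Prop`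
  structure bundling Phillips' property A in the form consumed by `HolonomicNear.transport`).
* `Literature.Topology.Immersions.Phillips1967_exists_isLocalDiffeomorph_of_isParallelizable_of_compressibleExhaustion`
  — the assembly theorem.

## References

* A. Phillips, *Submersions of open manifolds*, Topology **6** (1967): §1 (Lemma 1.1, Def. p. 176,
  Cor. 1.2), Lemma 4.7, §6, pp. 194–196. [Phillips1967]
-/

open scoped Manifold ContDiff Topology
open Set Function Filter Bundle Module

noncomputable section

namespace Literature.Topology.Immersions

/-- Local notation: `𝔼 n` is the model Euclidean space `EuclideanSpace ℝ (Fin n)`. -/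
local notation "𝔼 " n:arg => EuclideanSpace ℝ (Fin n)

variable {n : ℕ} {M : Type*} [TopologicalSpace M] [ChartedSpace (𝔼 n) M]

/-- **The trivial formal submersion**: the pair `(0, standard frame)` — constant map and constant
formal derivative `Ψ x i = eᵢ` — is a formal submersion of any framed manifold, holonomic near
the empty set. This is the base of the induction over an exhaustion starting at `K₁ = ∅`.
[folklore] -/
theorem holonomicNear_empty (σ : Fin n → M → 𝔼 n) :
    HolonomicNear σ (fun _ => 0) (fun _ i => EuclideanSpace.single i (1 : ℝ)) ∅ := by
  refine ⟨contMDiff_const, continuous_const, fun x => ?_, by simp [nhdsSet_empty]⟩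
  have h := (EuclideanSpace.basisFun (Fin n) ℝ).toBasis.linearIndependent
  have hfun : (⇑(EuclideanSpace.basisFun (Fin n) ℝ) : Fin n → EuclideanSpace ℝ (Fin n)) =
      fun i => EuclideanSpace.single i (1 : ℝ) := by
    funext i
    exact EuclideanSpace.basisFun_apply (Fin n) ℝ i
  rw [OrthonormalBasis.coe_toBasis, hfun] at h
  exact h

/-- **Compression datum** (Phillips 1967, Def. p. 176, property A, in the form consumed by
`HolonomicNear.transport`): a `C^∞` family `Φ : ℝ × M → M` whose slices `Φ(s, ·)`, `s ∈ [0, 1]`,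
have everywhere invertible differential and fix the set `K` pointwise, and a `C^∞` cut-off
`τ : M → [0, 1]` equal to `1` on the open set `W ⊇ K'`, such that `Φ(1, ·)` maps `W` into `V`
("`W` is compressed into `V`, keeping `K` fixed"). [cite: Phillips1967, Def. p. 176] -/
structure IsCompressionDatum (n : ℕ) {M : Type*} [TopologicalSpace M] [ChartedSpace (𝔼 n) M]
    (Φ : ℝ × M → M) (τ : M → ℝ) (W K K' V : Set M) : Prop where
  contMDiff : ContMDiff (𝓘(ℝ, ℝ).prod (𝓡 n)) (𝓡 n) ∞ Φ
  isInvertible : ∀ s ∈ Icc (0 : ℝ) 1, ∀ x, (mfderiv (𝓡 n) (𝓡 n) (fun z => Φ (s, z)) x).IsInvertible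
  contMDiff_cutoff : ContMDiff (𝓡 n) 𝓘(ℝ, ℝ) ∞ τ
  cutoff_mem : ∀ x, τ x ∈ Icc (0 : ℝ) 1
  isOpen : IsOpen W
  subset : K' ⊆ W
  cutoff_eq_one : ∀ x ∈ W, τ x = 1
  maps_into : ∀ x ∈ W, Φ (1, x) ∈ V
  fixes : ∀ x ∈ K, ∀ s, Φ (s, x) = x

/-- **One step of the induction from extension + compression.** If every formal submersion
holonomic near `K₁` extends to one holonomic near the closed set `A` with the same map on `K₀`,
and every open neighbourhood of `A` receives a compression of a neighbourhood of `K₂` fixing `K₀`,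
then every formal submersion holonomic near `K₁` can be replaced by one holonomic near `K₂` with
the same map on `K₀` (extend, then transport). [cite: Phillips1967, Lemma 4.7 and §6] -/
theorem HolonomicNear.step [IsManifold (𝓡 n) ∞ M] {σ : Fin n → M → 𝔼 n}
    (hσ : ∀ i, Continuous fun x => (⟨x, σ i x⟩ : TangentBundle (𝓡 n) M))
    (hli : ∀ x, LinearIndependent ℝ fun i => σ i x) {K₀ K₁ K₂ A : Set M}
    (hext : ∀ (f : M → 𝔼 n) (Ψ : M → Fin n → 𝔼 n), HolonomicNear σ f Ψ K₁ →
      ∃ (g : M → 𝔼 n) (Ψ' : M → Fin n → 𝔼 n), HolonomicNear σ g Ψ' A ∧ EqOn g f K₀)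
    (hcomp : ∀ V : Set M, IsOpen V → A ⊆ V →
      ∃ (Φ : ℝ × M → M) (τ : M → ℝ) (W : Set M), IsCompressionDatum n Φ τ W K₀ K₂ V)
    {f : M → 𝔼 n} {Ψ : M → Fin n → 𝔼 n} (h : HolonomicNear σ f Ψ K₁) :
    ∃ (g : M → 𝔼 n) (Ψ' : M → Fin n → 𝔼 n), HolonomicNear σ g Ψ' K₂ ∧ EqOn g f K₀ := by
  obtain ⟨g₁, Ψ₁, hg₁, hg₁f⟩ := hext f Ψ h
  obtain ⟨V, hV, hAV, hVeq⟩ := hg₁.exists_isOpen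
  have hg₁V : HolonomicNear σ g₁ Ψ₁ V :=
    HolonomicNear.of_isOpen hV hg₁.contMDiff hg₁.continuous hg₁.linearIndependent hVeq
  obtain ⟨Φ, τ, W, hc⟩ := hcomp V hV hAV
  obtain ⟨Ψ₂, hΨ₂⟩ := hg₁V.transport hσ hli hc.contMDiff hc.isInvertible hc.contMDiff_cutoff
    hc.cutoff_mem hc.isOpen hc.cutoff_eq_one hc.maps_into
  refine ⟨fun x => g₁ (Φ (τ x, x)), Ψ₂, hΨ₂.mono hc.subset, fun x hx => ?_⟩
  show g₁ (Φ (τ x, x)) = f x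
  rw [hc.fixes x hx, hg₁f hx]

/-- **Phillips' Cor. 8.2 ("if") from a compressible exhaustion** — the assembly of the tree's
analytic side. Suppose that every connected non-compact `C^∞` `n`-manifold `M` (Hausdorff, second
countable, `2 ≤ n`) with a continuous global frame `σ` admits subsets `K₀ ⊆ K₁ ⊆ ⋯` with interiors
covering `M`, `K₁ = ∅`, and sets `Aⱼ` such that for every `j`: (extension) every formal
submersion holonomic near `K_{j+1}` extends to one holonomic near `Aⱼ` with the same map on `Kⱼ`,
and (compression) every open `V ⊇ Aⱼ` receives a compression datum of a neighbourhood of `K_{j+2}`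
fixing `Kⱼ` — Phillips' handle presentation without `n`-handles (Cor. 1.2), the extensions being
the tree's `HolonomicNear.insert` / `HolonomicNear.arc` / holonomic approximation over the cores,
the compressions the collar-like neighbourhoods and handle shrinkings. Then the named fact
`Literature.Topology.Immersions.Phillips1967_exists_isLocalDiffeomorph_of_isParallelizable` holds.
[cite: Phillips1967, Cor. 1.2, §6 and Cor. 8.2] -/
theorem Phillips1967_exists_isLocalDiffeomorph_of_isParallelizable_of_compressibleExhaustion
    (h : ∀ (n : ℕ) (M : Type) [TopologicalSpace M] [T2Space M] [SecondCountableTopology M]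
      [ChartedSpace (EuclideanSpace ℝ (Fin n)) M] [IsManifold (𝓡 n) ∞ M] [ConnectedSpace M]
      [NoncompactSpace M] (σ : Fin n → M → EuclideanSpace ℝ (Fin n)),
      2 ≤ n →
      (∀ i, Continuous fun x => (⟨x, σ i x⟩ : TangentBundle (𝓡 n) M)) →
      (∀ x, LinearIndependent ℝ fun i => σ i x) →
        ∃ K A : ℕ → Set M, (∀ j, K j ⊆ K (j + 1)) ∧ (∀ x, ∃ j, x ∈ interior (K j)) ∧ K 1 = ∅ ∧
          (∀ (j : ℕ) (f : M → EuclideanSpace ℝ (Fin n)) (Ψ : M → Fin n → EuclideanSpace ℝ (Fin n)),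
            HolonomicNear σ f Ψ (K (j + 1)) →
              ∃ (g : M → EuclideanSpace ℝ (Fin n)) (Ψ' : M → Fin n → EuclideanSpace ℝ (Fin n)),
                HolonomicNear σ g Ψ' (A j) ∧ EqOn g f (K j)) ∧
          (∀ (j : ℕ) (V : Set M), IsOpen V → A j ⊆ V →
            ∃ (Φ : ℝ × M → M) (τ : M → ℝ) (W : Set M),
              IsCompressionDatum n Φ τ W (K j) (K (j + 2)) V)) :
    Phillips1967_exists_isLocalDiffeomorph_of_isParallelizable := by
  refine Phillips1967_exists_isLocalDiffeomorph_of_isParallelizable_of_exhaustion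
    fun n M _ _ _ _ _ _ _ σ hn hσ hli => ?_
  obtain ⟨K, A, hmono, hcov, hK1, hext, hcomp⟩ := h n M σ hn hσ hli
  refine ⟨K, hmono, hcov, ?_, fun j f Ψ hf => ?_⟩
  · rw [hK1]
    exact ⟨_, _, holonomicNear_empty σ⟩
  · exact HolonomicNear.step hσ hli (hext j) (hcomp j) hf

end Literature.Topology.Immersions
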